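import Literature.Analysis.FluidPDE.JiaSverak2013LimitingProcedureHolds
import Literature.Analysis.FluidPDE.JiaSverak2013Lemma8Holds
import Literature.Analysis.FluidPDE.DivFreeL3Approximation
import Literature.Analysis.FluidPDE.LerayHopfSuitableLocalEnergy
import Literature.Analysis.FluidPDE.LocalLerayTower
import Literature.Analysis.FluidPDE.LocalLerayWeakStrongViscosity
import Literature.Analysis.FluidPDE.KatoLerayHopf
import HarnessLib

/-!
# Leray solutions for `L³` data from Leray solutions for finite-energy data
# (Jia–Šverák 2013, §2 Remarks after Def. 1 and §4): the reduction of
# `leray_solution_exists_of_memLp_three` (**E**) to the suitability of Leray's weak solutions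

Analysis/FluidPDE proof file (theorems only: no definition, no named fact, no `sorry`) on the
discharge path of the named fact
`Literature.Analysis.FluidPDE.leray_solution_exists_of_memLp_three` (**E**,
`RusinSverakLeraySolutions.lean`: every weakly divergence-free `u₀ ∈ L³(ℝ³)` is the datum of a
global local Leray solution `IsLocalLeraySolution 1 u₀ u p`, i.e. Jia–Šverák's `𝒩(u₀) ≠ ∅`).

The cited source (H. Jia, V. Šverák, SIAM J. Math. Anal. 45 (2013) = arXiv:1201.1592, §2,
Remarks after Def. 1, p. 3) prints: "The existence of Leray solutions for very general initial
data is proved in [Lemarié-Rieusset 2002]. In our situation with initial data `u₀` in `L³` we can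
follow [Calderón 1990, Rusin–Šverák 2011] **or see section 4 below**", section 4 being the proof of
Thm. 1 (arXiv p. 8): "By compactness as in Lemma 5, and weak continuity in `t` we can find a
subsequence of `u^k` … and a suitable weak solution `u` to NSE, such that: `u^k → u` in
`L³(B₁(x₀) × (0,1))` …, `u₀^k ⇀ u₀` in `L³(ℝ³)` … we see `u` is a Leray solution with initial data
`u₀`". This file formalises that sentence as a construction of `𝒩(u₀)`: **a Leray solution with
datum `u₀ ∈ L³` is obtained as the limit of Leray solutions whose data are, in addition, of finite
energy.** All the analysis is in the tree:

* the approximation of a weakly divergence-free `u₀ ∈ L³` in `L³` by weakly divergence-free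
  fields `a_k ∈ L² ∩ L³` (`exists_seq_isWeaklyDivFree_memLp_two_three_tendsto`,
  `DivFreeL3Approximation.lean`: mollification and a Newtonian divergence-free truncation);
* Jia–Šverák's weak `L³` stability of local Leray solutions **K₃**
  (`jia_sverak_leray_weak_stability`, `NSLerayHopfSereginStability.lean`), whose three leaves are
  theorems — Lemma 2 (`jia_sverak_2013_lemma_2_holds`), Lemma 8 (`jia_sverak_2013_lemma_8_holds`)
  and the identification of the limit (`localLeray_limit_isLocalLeraySolution_holds`) — so that
  **K₃ is discharged here** (`jia_sverak_leray_weak_stability_holds`, the composition announced in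
  `LerayL3WeakStabilityThreeLeaves.lean`);
* the identification of the weak `L³` limit of the data with `u₀` (pairings with test fields
  pass to the limit along `a_k → u₀` in `L³`, `tendsto_integral_inner_of_tendsto_eLpNorm_three`;
  du Bois-Reymond, `FunctionSpaces.ae_eq_of_forall_integral_inner_test_eq`), the datum of a local
  Leray solution being defined up to a null set (`IsLocalLeraySolution.congr_datum`).

Hence (`leray_solution_exists_of_memLp_three_of_memLp_two`) **E** follows from the existence of
global local Leray solutions for weakly divergence-free data in `L² ∩ L³` — Leray's theorem
(`leray_existence_R3_holds`, Leray 1934) together with the suitability of Leray's weak solutions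
(Caffarelli–Kohn–Nirenberg 1982, Appendix; Lemarié-Rieusset 2016, Thm. 12.2 with Prop. 14.3 /
Thm. 13.6, §14.9 p. 549: "when `u₀ ∈ L²`, Leray's mollification and Rellich's theorem give a
solution … which is suitable"), packaged by the tree's
`IsGlobalLerayHopf.exists_forall_isLocalEnergySolutionOn_of_suitable_Ioi`
(`LerayHopfSuitableLocalEnergy.lean`), `IsLocalEnergySolutionOn.isLocalLeraySolutionOn`
(Kang–Miura–Tsai Lemma 3.3) and the tower lemma `exists_isLocalLeraySolution_of_tower`:
`leray_solution_exists_of_memLp_three_of_suitable_lerayHopf`. The suitability of Leray's weak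
solutions is being proved in the tree along Leray's regularised scheme
(`LeraySchemeConvergence.lean`, `LeraySchemePressure.lean`, `LeraySchemePressureLp.lean`,
`LeraySchemePressureBounds.lean`); once it lands, `leray_solution_exists_of_memLp_three_holds` is the
one-line application of `leray_solution_exists_of_memLp_three_of_suitable_lerayHopf`.

This route to **E** is independent of (and shorter than) the extension-step route
`leray_solution_exists_of_memLp_three_of_extension : localEnergySolution_extension_of_memE2 → E`
(`LocalEnergyExtension.lean`), which needs the unit-time existence of local energy solutions for
`E̊₃` data (uniformly local spaces); for `L³` data no uniformly local theory is required.

## Main results (all proved; no hypotheses beyond those displayed)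

* `jia_sverak_leray_weak_stability_holds : jia_sverak_leray_weak_stability` (**K₃ discharged**);
* `exists_isLocalLeraySolution_of_forall_isLocalEnergySolutionOn` — a pair which is a local
  energy solution on every strip `ℝ³ × (0, T)` is (up to the choice of representative made by the
  tower lemma, which here changes nothing at positive times) a global local Leray solution;
* `leray_solution_exists_of_memLp_three_of_memLp_two` — **E** from the existence of global local
  Leray solutions for weakly divergence-free data in `L² ∩ L³`;
* `leray_solution_exists_of_memLp_three_of_suitable_lerayHopf` — **E** from: every weakly
  divergence-free `a ∈ L² ∩ L³` has a global Leray–Hopf weak solution `u` and a pressure `p` with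
  `(u, p)` suitable on `(0, ∞) × ℝ³` and `p ∈ L^{3/2}((0,T) × K)` for all `T`, `K` compact.

## Mathlib / tree search

Tree (all used by name): `exists_seq_isWeaklyDivFree_memLp_two_three_tendsto`
(`DivFreeL3Approximation`); `jia_sverak_leray_weak_stability_of_three_leaves`
(`LerayL3WeakStabilityThreeLeaves`), `jia_sverak_2013_lemma_2_holds`
(`JiaSverak2013AprioriEstimateProofs`), `jia_sverak_2013_lemma_8_holds` (`JiaSverak2013Lemma8Holds`),
`localLeray_limit_isLocalLeraySolution_holds` (`LocalLerayLimitIdentification`);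
`tendsto_integral_inner_of_tendsto_eLpNorm_three` (`KatoLerayHopf`);
`FunctionSpaces.ae_eq_of_forall_integral_inner_test_eq` (`FunctionSpaces/TestPairingLimits`);
`IsLocalLeraySolution.congr_datum` (`LocalLerayWeakStrongViscosity`);
`IsGlobalLerayHopf.exists_forall_isLocalEnergySolutionOn_of_suitable_Ioi`
(`LerayHopfSuitableLocalEnergy`); `IsLocalEnergySolutionOn.isLocalLeraySolutionOn`
(`LocalEnergySolutionsOn`); `exists_isLocalLeraySolution_of_tower` (`LocalLerayTower`). Mathlib:
`Continuous.memLp_of_hasCompactSupport`, `eLpNorm_add_le`, `tendsto_nhds_unique`.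
`lean search 'jia_sverak_leray_weak_stability_holds|of_suitable_lerayHopf|_three_of_memLp_two'
--decl`: no declaration before this file (2026-08-15T23:10Z).

## References

* H. Jia, V. Šverák, *Minimal `L³`-initial data for potential Navier–Stokes singularities*,
  SIAM J. Math. Anal. 45 (2013) 1448–1459 = arXiv:1201.1592: §2 Def. 1 and Remarks (p. 3);
  §4, proof of Thm. 1 (p. 8). [`JiaSverak2013`]
* J. Leray, Acta Math. 63 (1934), Ch. V §31, Théorème d'existence. [`Leray1934`]
* L. Caffarelli, R. Kohn, L. Nirenberg, CPAM 35 (1982), Appendix. [`CaffarelliKohnNirenberg1982`]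
* P. G. Lemarié-Rieusset, *The Navier–Stokes Problem in the 21st Century* (2016),
  doi:10.1201/b19556: Thm. 12.2, Thm. 13.6, Prop. 14.3, Thm. 14.8, §14.9 (PDF p. 549).
  [`LemarieRieusset2016`]
* K. Kang, H. Miura, T.-P. Tsai, IMRN 2021 = arXiv:1812.10509, §3, Def. 3.1–3.2, Lemma 3.3.
  [`KangMiuraTsai2020`]
-/

noncomputable section

open MeasureTheory TopologicalSpace Set Function Filter Metric
open _root_.Topology
open scoped ENNReal NNReal RealInnerProductSpace

namespace Literature.Analysis.FluidPDE

/-! ## K₃ is a theorem -/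

/-- **Jia–Šverák's weak `L³` stability of local Leray solutions (K₃), discharged**: the accepted
reduction `jia_sverak_leray_weak_stability_of_three_leaves : Lemma 2 → Lemma 8 → (I) → K₃`
(`LerayL3WeakStabilityThreeLeaves.lean`) applied to the three discharges
`jia_sverak_2013_lemma_2_holds`, `jia_sverak_2013_lemma_8_holds`,
`localLeray_limit_isLocalLeraySolution_holds`.
[cite: JiaSverak2013, proof of Thm. 1 with Lemma 2, Cor. 1, Lemma 5 and Lemma 8 (arXiv:1201.1592 pp. 3–8)] -/
theorem jia_sverak_leray_weak_stability_holds : jia_sverak_leray_weak_stability :=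
  jia_sverak_leray_weak_stability_of_three_leaves jia_sverak_2013_lemma_2_holds
    jia_sverak_2013_lemma_8_holds localLeray_limit_isLocalLeraySolution_holds

/-! ## From the strips `ℝ³ × (0, T)` to the global class -/

/-- **A local energy solution on every strip is a global local Leray solution.** If one pair
`(v, π)` is a local energy solution (Seregin's Def. B.1 = Kang–Miura–Tsai Def. 3.1) on
`ℝ³ × (0, T)` for every `T > 0`, then there is a global local Leray solution (Kang–Miura–Tsai
Def. 3.2 on `ℝ³ × (0, ∞)`) with the same datum which coincides with `(v, π)` at every positive
time: project each strip onto the slab class (`IsLocalEnergySolutionOn.isLocalLeraySolutionOn`,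
Kang–Miura–Tsai Lemma 3.3) and glue the constant tower on the strips `(0, n + 1)`
(`exists_isLocalLeraySolution_of_tower`, Lemarié-Rieusset 2016, Thm. 14.8, proof, Step 3).
[cite: KangMiuraTsai2020, Lemma 3.3 with Def. 3.1–3.2] [cite: LemarieRieusset2016, Thm. 14.8, proof, Step 3 (PDF p. 527)] -/
theorem exists_isLocalLeraySolution_of_forall_isLocalEnergySolutionOn {ν : ℝ}
    {v₀ : EuclideanSpace ℝ (Fin 3) → EuclideanSpace ℝ (Fin 3)}
    {v : ℝ → EuclideanSpace ℝ (Fin 3) → EuclideanSpace ℝ (Fin 3)}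
    {π : ℝ → EuclideanSpace ℝ (Fin 3) → ℝ}
    (h : ∀ T : ℝ, 0 < T → IsLocalEnergySolutionOn T ν v₀ v π) :
    ∃ (u : ℝ → EuclideanSpace ℝ (Fin 3) → EuclideanSpace ℝ (Fin 3))
      (p : ℝ → EuclideanSpace ℝ (Fin 3) → ℝ), IsLocalLeraySolution ν v₀ u p ∧
      ∀ t : ℝ, 0 < t → u t = v t ∧ p t = π t := by
  have hmono : Monotone (fun n : ℕ => (n : ℝ) + 1) := fun m n hmn => by
    have : (m : ℝ) ≤ n := by exact_mod_cast hmn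
    show (m : ℝ) + 1 ≤ n + 1
    linarith
  have hS : Tendsto (fun n : ℕ => (n : ℝ) + 1) atTop atTop :=
    tendsto_atTop_add_const_right _ 1 tendsto_natCast_atTop_atTop
  obtain ⟨u, p, hup, hagree⟩ := exists_isLocalLeraySolution_of_tower (ν := ν) (v₀ := v₀)
    (S := fun n : ℕ => (n : ℝ) + 1) hmono hS (v := fun _ => v) (π := fun _ => π)
    (fun n => (h ((n : ℝ) + 1) (by positivity)).isLocalLeraySolutionOn)
    (fun _ _ _ _ _ => ⟨rfl, rfl⟩)
  refine ⟨u, p, hup, fun t ht => ?_⟩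
  obtain ⟨n, hn⟩ := exists_nat_gt t
  exact hagree n t ⟨ht, by linarith⟩

/-! ## E from the existence of Leray solutions for finite-energy data -/

/-- **Leray solutions for `L³` data from Leray solutions for data in `L² ∩ L³`** (Jia–Šverák
2013, §2, Remarks after Def. 1: "In our situation with initial data `u₀` in `L³` we can follow
[Calderón, Rusin–Šverák] or see section 4 below"; §4, proof of Thm. 1, arXiv:1201.1592 p. 8: "By
compactness as in Lemma 5, and weak continuity in `t` we can find a subsequence of `u^k` … and a
suitable weak solution `u` to NSE, such that: `u^k → u` in `L³(B₁(x₀) × (0,1))` … `u₀^k ⇀ u₀` in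
`L³(ℝ³)` … Thus `u` satisfies the decay condition … we see `u` is a Leray solution with initial
data `u₀`"). If every weakly divergence-free `a ∈ L² ∩ L³` is the datum of a global local Leray
solution, then so is every weakly divergence-free `u₀ ∈ L³`
(`leray_solution_exists_of_memLp_three`). Proof: approximate `u₀` in `L³` by weakly
divergence-free `a_k ∈ L² ∩ L³` (`exists_seq_isWeaklyDivFree_memLp_two_three_tendsto`), discard an
initial segment so that `‖a_k‖₃ ≤ ‖u₀‖₃ + 1`, take Leray solutions `u^k ∈ 𝒩(a_k)` (the hypothesis)
and apply the weak stability theorem **K₃** (`jia_sverak_leray_weak_stability_holds`): along a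
subsequence the data converge weakly (against test fields) to some `a' ∈ L³` admitting a Leray
solution `U ∈ 𝒩(a')`; as `a_k → u₀` strongly in `L³` the same pairings converge to those of `u₀`
(`tendsto_integral_inner_of_tendsto_eLpNorm_three`), so `a' = u₀` a.e.
(`FunctionSpaces.ae_eq_of_forall_integral_inner_test_eq`) and `U ∈ 𝒩(u₀)`
(`IsLocalLeraySolution.congr_datum`).
[cite: JiaSverak2013, §2 Remarks after Def. 1 (arXiv:1201.1592 p. 3) and §4 proof of Thm. 1 (p. 8)] -/
theorem leray_solution_exists_of_memLp_three_of_memLp_two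
    (hL2 : ∀ a : EuclideanSpace ℝ (Fin 3) → EuclideanSpace ℝ (Fin 3),
      MemLp a 2 volume → MemLp a 3 volume → IsWeaklyDivFree a →
      ∃ (v : ℝ → EuclideanSpace ℝ (Fin 3) → EuclideanSpace ℝ (Fin 3))
        (π : ℝ → EuclideanSpace ℝ (Fin 3) → ℝ), IsLocalLeraySolution 1 a v π) :
    leray_solution_exists_of_memLp_three := by
  intro u₀ hu₀ hdiv
  -- finite-energy approximants `a k → u₀` in `L³`
  obtain ⟨a, ha, hlim⟩ := exists_seq_isWeaklyDivFree_memLp_two_three_tendsto hu₀ hdiv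
  -- discard an initial segment so that `‖a k - u₀‖₃ ≤ 1`
  obtain ⟨k₀, hk₀⟩ : ∃ k₀, ∀ k ≥ k₀, eLpNorm (a k - u₀) 3 volume ≤ 1 :=
    eventually_atTop.1 (hlim.eventually (Iic_mem_nhds zero_lt_one))
  set b : ℕ → EuclideanSpace ℝ (Fin 3) → EuclideanSpace ℝ (Fin 3) := fun k => a (k + k₀) with hb
  have hb2 : ∀ k, MemLp (b k) 2 volume := fun k => (ha (k + k₀)).1
  have hb3 : ∀ k, MemLp (b k) 3 volume := fun k => (ha (k + k₀)).2.1
  have hbdiv : ∀ k, IsWeaklyDivFree (b k) := fun k => (ha (k + k₀)).2.2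
  have hblim : Tendsto (fun k => eLpNorm (b k - u₀) 3 volume) atTop (𝓝 0) :=
    hlim.comp (tendsto_add_atTop_nat k₀)
  -- the uniform bound `‖b k‖₃ ≤ ‖u₀‖₃ + 1`
  have hfin : eLpNorm u₀ 3 volume + 1 ≠ ∞ :=
    ENNReal.add_ne_top.2 ⟨hu₀.eLpNorm_ne_top, ENNReal.one_ne_top⟩
  set M : ℝ≥0 := (eLpNorm u₀ 3 volume + 1).toNNReal with hM
  have hMeq : (M : ℝ≥0∞) = eLpNorm u₀ 3 volume + 1 := ENNReal.coe_toNNReal hfin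
  have hbM : ∀ k, eLpNorm (b k) 3 volume ≤ M := by
    intro k
    rw [hMeq]
    have hsplit : b k = (b k - u₀) + u₀ := (sub_add_cancel _ _).symm
    calc eLpNorm (b k) 3 volume = eLpNorm ((b k - u₀) + u₀) 3 volume := by rw [← hsplit]
      _ ≤ eLpNorm (b k - u₀) 3 volume + eLpNorm u₀ 3 volume :=
          eLpNorm_add_le ((hb3 k).1.sub hu₀.1) hu₀.1 (by norm_num)
      _ ≤ 1 + eLpNorm u₀ 3 volume := by
          gcongr
          exact hk₀ (k + k₀) (Nat.le_add_left _ _)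
      _ = eLpNorm u₀ 3 volume + 1 := add_comm _ _
  -- Leray solutions of the approximants (the hypothesis)
  choose v π hvπ using fun k => hL2 (b k) (hb2 k) (hb3 k) (hbdiv k)
  -- weak stability (K₃)
  obtain ⟨σ, a', U, P, q, hσ, ha'3, -, -, hweak, hUP, -, -, -⟩ :=
    jia_sverak_leray_weak_stability_holds M b v π (fun k => ⟨hb3 k, hbdiv k, hbM k⟩) hvπ
  -- identification of the weak limit of the data with `u₀`
  have hae : a' =ᵐ[volume] u₀ := by
    refine FunctionSpaces.ae_eq_of_forall_integral_inner_test_eq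
      (ha'3.locallyIntegrable (by norm_num)) (hu₀.locallyIntegrable (by norm_num)) fun φ hφ => ?_
    have hφ32 : MemLp φ (3 / 2) volume :=
      hφ.contDiff.continuous.memLp_of_hasCompactSupport hφ.hasCompactSupport
    have h1 : Tendsto (fun k => ∫ x, ⟪b (σ k) x, φ x⟫) atTop (𝓝 (∫ x, ⟪u₀ x, φ x⟫)) :=
      tendsto_integral_inner_of_tendsto_eLpNorm_three (Eventually.of_forall fun k => hb3 (σ k))
        hu₀ hφ32 (hblim.comp hσ.tendsto_atTop)
    exact tendsto_nhds_unique (hweak φ hφ) h1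
  exact ⟨U, P, hUP.congr_datum hae.symm⟩

/-! ## E from the suitability of Leray's weak solutions -/

/-- **Leray solutions for `L³` data from suitable Leray–Hopf weak solutions for finite-energy
data.** If every weakly divergence-free `a ∈ L² ∩ L³` has a global Leray–Hopf weak solution `u`
of the unit-viscosity equations (Leray 1934, Théorème d'existence; `leray_existence_R3_holds`)
together with a pressure `p` such that `(u, p)` is suitable on `(0, ∞) × ℝ³` and
`p ∈ L^{3/2}((0, T) × K)` for every `T > 0` and compact `K` (Caffarelli–Kohn–Nirenberg 1982,
Appendix: "the weak solutions constructed by Leray are suitable"; Lemarié-Rieusset 2016, §14.9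
p. 549 with Thm. 12.2 and Thm. 13.6), then every weakly divergence-free `u₀ ∈ L³` is the datum
of a global local Leray solution (`leray_solution_exists_of_memLp_three`). Proof: such a pair is a
local energy solution on every strip
(`IsGlobalLerayHopf.exists_forall_isLocalEnergySolutionOn_of_suitable_Ioi`, with the slice at
`t = 0` reset to the datum), hence a global local Leray solution
(`exists_isLocalLeraySolution_of_forall_isLocalEnergySolutionOn`), and
`leray_solution_exists_of_memLp_three_of_memLp_two` applies.
[cite: JiaSverak2013, §2 Remarks after Def. 1 (arXiv:1201.1592 p. 3) and §4 proof of Thm. 1 (p. 8)] [cite: LemarieRieusset2016, §14.9 (PDF p. 549) with Thm. 12.2, Thm. 13.6] -/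
theorem leray_solution_exists_of_memLp_three_of_suitable_lerayHopf
    (hS : ∀ a : EuclideanSpace ℝ (Fin 3) → EuclideanSpace ℝ (Fin 3),
      MemLp a 2 volume → MemLp a 3 volume → IsWeaklyDivFree a →
      ∃ (u : ℝ → EuclideanSpace ℝ (Fin 3) → EuclideanSpace ℝ (Fin 3))
        (p : ℝ → EuclideanSpace ℝ (Fin 3) → ℝ), IsGlobalLerayHopf 1 0 a u ∧
        IsSuitableWeakSolutionOn (slab (EuclideanSpace ℝ (Fin 3)) (Ioi 0) isOpen_Ioi) 1 0 u p ∧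
        ∀ T : ℝ, 0 < T → ∀ K : Set (EuclideanSpace ℝ (Fin 3)), IsCompact K →
          ∫⁻ z in Ioo 0 T ×ˢ K, ‖p z.1 z.2‖ₑ ^ (3 / 2 : ℝ) < ∞) :
    leray_solution_exists_of_memLp_three := by
  refine leray_solution_exists_of_memLp_three_of_memLp_two fun a ha2 ha3 hdiv => ?_
  obtain ⟨u, p, hLH, hsuit, hp⟩ := hS a ha2 ha3 hdiv
  obtain ⟨v, -, hv⟩ :=
    hLH.exists_forall_isLocalEnergySolutionOn_of_suitable_Ioi one_pos ha2 hsuit hp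
  obtain ⟨w, q, hwq, -⟩ := exists_isLocalLeraySolution_of_forall_isLocalEnergySolutionOn hv
  exact ⟨w, q, hwq⟩

end Literature.Analysis.FluidPDE
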